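import Mathlib
import Summits.ValiantsHypothesis.ValiantsHypothesis.Theorems.GeneratorObstructionsGenFlipThesisChowDichotomy
import Summits.ValiantsHypothesis.ValiantsHypothesis.Theorems.GeneratorObstructionsGenFlipThesisGammaEquality
import Summits.ValiantsHypothesis.ValiantsHypothesis.Theorems.GeneratorObstructionsPowGenDegreeQPWideRegime

/-!
# K2 `PowGenDegreeQP` (stmt-ValiantsHypothesis-11655), line `trace-side-regimes`:
# the decisive Chow test lives on `m` letters — `A(Ch_m(ℂ^{m²}))` versus `A(Δ_{GL_m}(x₁⋯x_m))`

Helper file (`--supports stmt-ValiantsHypothesis-11655`).  The tree's CHOW DICHOTOMY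
(`GeneratorObstructionsGenFlipThesisChowDichotomy.chowLate_dichotomy`): if the covariant algebra
`A(Δ(x₁₁x₂₂⋯x_mm))` of the Chow variety `Ch_m(ℂ^{m²})` (the diagonal monomial in the `m²`
lexicographic matrix letters `MatIdx m`, a `GL_{m²}`-variety) has generator types beyond every
quasi-polynomial degree cofinally in `m` ("Chow late"), then K1 = `PerGenDegreeSuperQP` holds and
K2 = `PowGenDegreeQP` (indeed already its registered slice stub `stub_sliceGen`) fails; and K2
forces quasi-polynomial generation of that algebra (`chowGenQP_of_powGenDegreeQP`).  That single
computation decides which half of the route's overflow engine survives.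

This file pins the computation to its MINIMAL ambient.  The monomial uses only `m` of the `m²`
letters, so by Bürgisser–Ikenmeyer–Panova's inheritance in weight form (JAMS 2019 Thm. 4.9(1),
tree: `apply_eq_zero_of_hasHighestWeight_orbitCoordRep_of_vars_subset`) every weight occurring in
`ℂ[Δ(x₁₁⋯x_mm)]` vanishes off the LAST `m` letters of `MatIdx m`, i.e. is `ext_ι χ` for the final
segment `ι : Fin m → MatIdx m` and a weight `χ` of `GL_m` (`chowDiag_weight_eq_extend`); and by
exact γ-inheritance along final segments (BLMW 2011 §5.4, tree:
`GammaEquality.finrank_rename_eq_of_injective`) the generator count of type `ext_ι χ` of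
`A(Δ_{GL_{m²}}(x₁₁⋯x_mm))` EQUALS the generator count of type `χ` of `A(Δ_{GL_m}(x₀x₁⋯x_{m-1}))`,
the covariant algebra of the Chow variety `Ch_m(ℂ^m)` of `m`-fold products of linear forms in ITS
OWN `m` letters (`gamma_chowDiag_extend_eq`).  Consequently:

* `chowDiag_genType_iff` — the generator types of `A(Ch_m(ℂ^{m²}))` are exactly the weights
  `ext_ι χ` with `χ` a generator type of `A(Ch_m(ℂ^m))` (same degree, `size_extend`);
* `chowLate_iff_chowLateOwn` — "Chow late" over `m²` letters ⟺ "Chow late" over `m` letters;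
* `chowLateOwn_dichotomy` — late generators of `A(Δ_{GL_m}(x₀⋯x_{m-1}))` cofinally in `m` give
  `PerGenDegreeSuperQP ∧ ¬ PowGenDegreeQP` (K1 proved, K2 refuted);
* `chowGenQPOwn_of_sliceGen`, `chowGenQPOwn_of_powGenDegreeQP`, `not_sliceGen_of_chowLateOwn` —
  the registered `stub_sliceGen` (hypothesis verbatim), a fortiori K2, forces the covariant algebra
  of `Ch_m(ℂ^m)` — `U`-invariants of `GL_m` on `Sym^m ℂ^m` modulo the ideal of `m`-fold products —
  to be generated in degree `2^((log₂ m + c₀)^c₀)`.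

So the test the planners' cards and the refuter memo `ATTACK-11655-ChowTransfer` describe
informally (level structure of `Flag_{SL_m}^{N(T)}`) is, by name, a statement about `GL_m` and `m`
letters only: for `m = 3` the covariants of ternary cubics on the triangle locus `xyz`, for `m = 4`
quaternary quartics on `xyzw` — the smallest objects on which a certified computation can bear on
BOTH leaves 11654/11655.  Honest framing: an equivalence and implications between OPEN statements;
`stub_sliceGen`, `stub_wideGen`, K1, K2 remain open; `VP ≠ VNP` is not touched.

References: Bürgisser–Ikenmeyer–Panova, J. AMS 32 (2019) Thm. 4.9(1); Bürgisser–Landsberg–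
Manivel–Weyman, SIAM J. Comput. 40 (2011) §5.4; Landsberg, *Geometry and Complexity Theory*
(2017) §8.4.1, §9; Derksen–Makam 2020 Lemma 1.3 (background).  No new definitions.
-/

namespace Summit.ValiantsHypothesis.ValiantsHypothesis.Theorems.GeneratorObstructions.PowGenDegreeQP

open MvPolynomial
open Literature.NumberTheory.DiophantineGeometry Literature.Computability.AlgebraicComplexity
open Summit.ValiantsHypothesis.ValiantsHypothesis.Theses.GeneratorObstructions
open Summit.ValiantsHypothesis.ValiantsHypothesis.Theorems.GenInheritance
open Summit.ValiantsHypothesis.ValiantsHypothesis.Theorems.GeneratorObstructions.SliceTransfer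
open Summit.ValiantsHypothesis.ValiantsHypothesis.Theorems.GeneratorObstructions.ChowDichotomy
open Summit.ValiantsHypothesis.ValiantsHypothesis.Theorems.GeneratorObstructions.GammaEquality

-- `Summit.ValiantsHypothesis.ValiantsHypothesis.…` is the tree's mandated single-conjunct layout.
set_option linter.dupNamespace false

noncomputable section

/-! ## 1. Letters: the diagonal placement and the final segment of `MatIdx m` -/

section Letters

/-- The diagonal placement `i ↦ (i,i)` of the `m` own letters among the `m²` matrix letters is
injective. [folklore] -/
theorem diag_toLex_injective (m : ℕ) :
    Function.Injective fun i : Fin m => (toLex (i, i) : MatIdx m) := by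
  intro i j hij
  have h := toLex.injective hij
  rw [Prod.mk.injEq] at h
  exact h.1

/-- The diagonal monomial of the route's Chow dichotomy is the own-letter monomial `x₀⋯x_{m-1}`
renamed along the diagonal placement. [folklore] -/
theorem rename_diag_prod_X (m : ℕ) :
    rename (fun i : Fin m => (toLex (i, i) : MatIdx m)) (∏ i : Fin m, (X i : MvPolynomial (Fin m) ℂ)) =
      ∏ i : Fin m, (X (toLex (i, i)) : MvPolynomial (MatIdx m) ℂ) := by
  rw [map_prod]
  simp only [rename_X]

/-- A final segment `Fin m → MatIdx m` (the last `m` of the `m²` lexicographic matrix letters)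
exists. [folklore] -/
theorem exists_finalSegment_fin (m : ℕ) :
    ∃ ι : Fin m → MatIdx m, StrictMono ι ∧ IsUpperSet (Set.range ι) :=
  exists_strictMono_isUpperSet (σ := Fin m) (τ := MatIdx m)
    (Fintype.card_le_of_injective _ (diag_toLex_injective m))

/-- **Off a final segment of `MatIdx m` one is among the bottom `m² - m` letters**: if
`ι : Fin m → MatIdx m` is strictly monotone onto an upper set and `x ∉ range ι`, then the
row-major index of `x` (`matIdxEquiv`) satisfies `idx(x) + m < m·m` — the upper set `range ι`
(`m` letters) lies strictly above `x`. [folklore] -/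
theorem matIdxEquiv_symm_add_lt_of_not_mem_range {m : ℕ} {ι : Fin m → MatIdx m}
    (hι : StrictMono ι) (hup : IsUpperSet (Set.range ι)) {x : MatIdx m} (hx : x ∉ Set.range ι) :
    (((matIdxEquiv m).symm x : Fin (m * m)) : ℕ) + m < m * m := by
  have hsub : Set.range ι ⊆ Set.Ioi x := by
    intro y hy
    rcases lt_or_ge x y with h | h
    · exact h
    · exact absurd (hup h hy) hx
  have h1 : (Set.range ι).ncard = m := by
    rw [Set.ncard_range_of_injective hι.injective, Nat.card_eq_fintype_card, Fintype.card_fin]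
  have h2 : (Set.Ioi x).ncard = m * m - 1 - (((matIdxEquiv m).symm x : Fin (m * m)) : ℕ) := by
    have hIoi : Set.Ioi x = matIdxEquiv m '' Set.Ioi ((matIdxEquiv m).symm x) := by
      rw [OrderIso.image_Ioi, OrderIso.apply_symm_apply]
    rw [hIoi, Set.ncard_image_of_injective _ (matIdxEquiv m).injective, ← Finset.coe_Ioi,
      Set.ncard_coe_finset, Fin.card_Ioi]
  have h3 := Set.ncard_le_ncard hsub (Set.toFinite _)
  have h4 := ((matIdxEquiv m).symm x).2
  omega

end Letters

/-! ## 2. Occurring weights of `ℂ[Δ(x₁₁⋯x_mm)]` live on the last `m` letters (BIP Thm. 4.9(1)) -/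

section Support

/-- The diagonal monomial uses only the `m` diagonal letters. [folklore] -/
theorem vars_prod_X_diag_subset (m : ℕ) :
    (↑(∏ i : Fin m, (X (toLex (i, i)) : MvPolynomial (MatIdx m) ℂ)).vars : Set (MatIdx m)) ⊆
      ↑(Finset.univ.image fun i : Fin m => (toLex (i, i) : MatIdx m)) := by
  classical
  intro x hx
  have h := vars_prod (s := (Finset.univ : Finset (Fin m)))
    (fun i : Fin m => (X (toLex (i, i)) : MvPolynomial (MatIdx m) ℂ)) (Finset.mem_coe.mp hx)
  rw [Finset.mem_biUnion] at h
  obtain ⟨i, -, hi⟩ := h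
  rw [vars_X, Finset.mem_singleton] at hi
  rw [Finset.mem_coe, Finset.mem_image]
  exact ⟨i, Finset.mem_univ _, hi.symm⟩

/-- **Weights of the Chow side are supported on the last `m` letters** (Bürgisser–Ikenmeyer–
Panova 2019 Thm. 4.9(1) in weight form, tree `apply_eq_zero_of_hasHighestWeight_orbitCoordRep_of_vars_subset`,
applied to `vars(x₁₁⋯x_mm) ⊆` the `m` diagonal letters): a weight `ψ` of `GL_{m²}` occurring in
`ℂ[Δ_m(x₁₁⋯x_mm)]` equals its restriction to the final segment `ι : Fin m → MatIdx m` extended by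
zero, `ψ = ext_ι (ψ ∘ ι)` — in partition language `ℓ(λ) ≤ m`. [cite: BurgisserIkenmeyerPanovaJAMS2019, Thm. 4.9(1)] -/
theorem chowDiag_weight_eq_extend {m : ℕ} {ι : Fin m → MatIdx m} (hι : StrictMono ι)
    (hup : IsUpperSet (Set.range ι)) {ψ : Weight (MatIdx m)}
    (hψ : HasHighestWeight (orbitCoordRep (∏ i : Fin m, (X (toLex (i, i)) : MvPolynomial (MatIdx m) ℂ)) m) ψ) :
    Function.extend ι (ψ ∘ ι) 0 = ψ := by
  classical
  funext x
  by_cases hx : ∃ j, ι j = x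
  · obtain ⟨j, rfl⟩ := hx
    rw [hι.injective.extend_apply, Function.comp_apply]
  · rw [Function.extend_apply' _ _ _ hx, Pi.zero_apply]
    have hx' : x ∉ Set.range ι := fun ⟨j, hj⟩ => hx ⟨j, hj⟩
    have hlt := matIdxEquiv_symm_add_lt_of_not_mem_range hι hup hx'
    have hcard : (Finset.univ.image fun i : Fin m => (toLex (i, i) : MatIdx m)).card = m := by
      rw [Finset.card_image_of_injective _ (diag_toLex_injective m), Finset.card_univ, Fintype.card_fin]
    have h := apply_eq_zero_of_hasHighestWeight_orbitCoordRep_of_vars_subset (m := m) (matIdxEquiv m)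
      (∏ i : Fin m, (X (toLex (i, i)) : MvPolynomial (MatIdx m) ℂ))
      (Finset.univ.image fun i : Fin m => (toLex (i, i) : MatIdx m)) (vars_prod_X_diag_subset m) hψ
      ((matIdxEquiv m).symm x) (by rw [hcard]; exact hlt)
    rw [OrderIso.apply_symm_apply] at h
    exact h.symm

end Support

/-! ## 3. Exact inheritance of the generator counts from the own letters -/

section Gamma

/-- **`γ_{ext_ι χ}(Δ_{GL_{m²}}(x₁₁⋯x_mm)) = γ_χ(Δ_{GL_m}(x₀⋯x_{m-1}))`** for the final segment
`ι : Fin m → MatIdx m` and every weight `χ` of `GL_m`: the diagonal placement and the final-segment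
placement of the own-letter monomial are conjugate under a permutation matrix, and γ is inherited
exactly along final segments (tree `finrank_rename_eq_of_injective`, BLMW 2011 §5.4). [folklore] -/
theorem gamma_chowDiag_extend_eq {m : ℕ} {ι : Fin m → MatIdx m} (hι : StrictMono ι)
    (hup : IsUpperSet (Set.range ι)) (χ : Weight (Fin m)) :
    Module.finrank ℂ (↥(highestWeightSpace (orbitCoordRep (∏ i : Fin m, (X (toLex (i, i)) : MvPolynomial (MatIdx m) ℂ)) m) (Function.extend ι χ 0)) ⧸ Submodule.comap (highestWeightSpace (orbitCoordRep (∏ i : Fin m, (X (toLex (i, i)) : MvPolynomial (MatIdx m) ℂ)) m) (Function.extend ι χ 0)).subtype (⨆ p : Weight (MatIdx m) × Weight (MatIdx m), ⨆ (_ : p.1 + p.2 = Function.extend ι χ 0 ∧ p.1 ≠ 0 ∧ p.2 ≠ 0), highestWeightSpace (orbitCoordRep (∏ i : Fin m, (X (toLex (i, i)) : MvPolynomial (MatIdx m) ℂ)) m) p.1 * highestWeightSpace (orbitCoordRep (∏ i : Fin m, (X (toLex (i, i)) : MvPolynomial (MatIdx m) ℂ)) m) p.2)) =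
    Module.finrank ℂ (↥(highestWeightSpace (orbitCoordRep (∏ i : Fin m, (X i : MvPolynomial (Fin m) ℂ)) m) χ) ⧸ Submodule.comap (highestWeightSpace (orbitCoordRep (∏ i : Fin m, (X i : MvPolynomial (Fin m) ℂ)) m) χ).subtype (⨆ p : Weight (Fin m) × Weight (Fin m), ⨆ (_ : p.1 + p.2 = χ ∧ p.1 ≠ 0 ∧ p.2 ≠ 0), highestWeightSpace (orbitCoordRep (∏ i : Fin m, (X i : MvPolynomial (Fin m) ℂ)) m) p.1 * highestWeightSpace (orbitCoordRep (∏ i : Fin m, (X i : MvPolynomial (Fin m) ℂ)) m) p.2)) := by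
  have hhom : (∏ i : Fin m, (X i : MvPolynomial (Fin m) ℂ)).IsHomogeneous m := by
    simpa using prod_X_isHomogeneous (σ := Fin m) (m := m) id
  have hne : (∏ i : Fin m, (X i : MvPolynomial (Fin m) ℂ)) ≠ 0 := by
    simpa using prod_X_ne_zero (σ := Fin m) (m := m) id
  have h := finrank_rename_eq_of_injective (m := m) (fun i : Fin m => (toLex (i, i) : MatIdx m))
    (diag_toLex_injective m) hι hup hhom hne χ
  rw [rename_diag_prod_X] at h
  exact h

/-- **Generator types of `A(Ch_m(ℂ^{m²}))` are exactly the extended generator types of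
`A(Ch_m(ℂ^m))`**: for the final segment `ι : Fin m → MatIdx m` and a weight `ψ` of `GL_{m²}`,
`γ_ψ(Δ(x₁₁⋯x_mm)) ≠ 0` iff `ψ = ext_ι(ψ ∘ ι)` and `γ_{ψ∘ι}(Δ_{GL_m}(x₀⋯x_{m-1})) ≠ 0`.
[folklore] -/
theorem chowDiag_genType_iff {m : ℕ} {ι : Fin m → MatIdx m} (hι : StrictMono ι)
    (hup : IsUpperSet (Set.range ι)) (ψ : Weight (MatIdx m)) :
    Module.finrank ℂ (↥(highestWeightSpace (orbitCoordRep (∏ i : Fin m, (X (toLex (i, i)) : MvPolynomial (MatIdx m) ℂ)) m) ψ) ⧸ Submodule.comap (highestWeightSpace (orbitCoordRep (∏ i : Fin m, (X (toLex (i, i)) : MvPolynomial (MatIdx m) ℂ)) m) ψ).subtype (⨆ p : Weight (MatIdx m) × Weight (MatIdx m), ⨆ (_ : p.1 + p.2 = ψ ∧ p.1 ≠ 0 ∧ p.2 ≠ 0), highestWeightSpace (orbitCoordRep (∏ i : Fin m, (X (toLex (i, i)) : MvPolynomial (MatIdx m) ℂ)) m) p.1 * highestWeightSpace (orbitCoordRep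 (∏ i : Fin m, (X (toLex (i, i)) : MvPolynomial (MatIdx m) ℂ)) m) p.2)) ≠ 0 ↔
    Function.extend ι (ψ ∘ ι) 0 = ψ ∧
    Module.finrank ℂ (↥(highestWeightSpace (orbitCoordRep (∏ i : Fin m, (X i : MvPolynomial (Fin m) ℂ)) m) (ψ ∘ ι)) ⧸ Submodule.comap (highestWeightSpace (orbitCoordRep (∏ i : Fin m, (X i : MvPolynomial (Fin m) ℂ)) m) (ψ ∘ ι)).subtype (⨆ p : Weight (Fin m) × Weight (Fin m), ⨆ (_ : p.1 + p.2 = (ψ ∘ ι) ∧ p.1 ≠ 0 ∧ p.2 ≠ 0), highestWeightSpace (orbitCoordRep (∏ i : Fin m, (X i : MvPolynomial (Fin m) ℂ)) m) p.1 * highestWeightSpace (orbitCoordRep (∏ i : Fin m, (X i : MvPolynomial (Fin m) ℂ)) m) p.2)) ≠ 0 := by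
  constructor
  · intro h
    have hψ : HasHighestWeight
        (orbitCoordRep (∏ i : Fin m, (X (toLex (i, i)) : MvPolynomial (MatIdx m) ℂ)) m) ψ :=
      ne_bot_of_finrank_quotient_ne_zero _ _ h
    have hext := chowDiag_weight_eq_extend hι hup hψ
    refine ⟨hext, ?_⟩
    rw [← gamma_chowDiag_extend_eq hι hup (ψ ∘ ι), hext]
    exact h
  · rintro ⟨hext, h⟩
    rw [← hext, gamma_chowDiag_extend_eq hι hup (ψ ∘ ι)]
    exact h

end Gamma

/-! ## 4. "Chow late" over `m²` letters ⟺ over `m` letters; the dichotomy and K2's consequence -/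

section Late

/-- **Chow late ⟺ Chow late on the own letters.**  The hypothesis of the tree's
`chowLate_dichotomy` (late generator types of `A(Δ_{GL_{m²}}(x₁₁⋯x_mm))`, cofinally in `m`,
beyond every quasi-polynomial degree) is EQUIVALENT to the same statement for the covariant
algebra of the Chow variety `Ch_m(ℂ^m) = Δ_{GL_m}(x₀⋯x_{m-1})` in its own `m` letters (weights
`Fin m → ℤ`). [folklore] -/
theorem chowLate_iff_chowLateOwn :
    (∀ c m₀ : ℕ, ∃ m : ℕ, m₀ ≤ m ∧ ∃ χ : Weight (MatIdx m),
      Module.finrank ℂ (↥(highestWeightSpace (orbitCoordRep (∏ i : Fin m, (X (toLex (i, i)) : MvPolynomial (MatIdx m) ℂ)) m) χ) ⧸ Submodule.comap (highestWeightSpace (orbitCoordRep (∏ i : Fin m, (X (toLex (i, i)) : MvPolynomial (MatIdx m) ℂ)) m) χ).subtype (⨆ p : Weight (MatIdx m) × Weight (MatIdx m), ⨆ (_ : p.1 + p.2 = χ ∧ p.1 ≠ 0 ∧ p.2 ≠ 0), highestWeightSpace (orbitCoordRep (∏ i : Fin m, (X (toLex (i, i)) : MvPolynomial (MatIdx m)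 ℂ)) m) p.1 * highestWeightSpace (orbitCoordRep (∏ i : Fin m, (X (toLex (i, i)) : MvPolynomial (MatIdx m) ℂ)) m) p.2)) ≠ 0 ∧
        (m : ℤ) * 2 ^ ((Nat.log 2 m + c) ^ c) < -(Weight.size χ)) ↔
    (∀ c m₀ : ℕ, ∃ m : ℕ, m₀ ≤ m ∧ ∃ χ : Weight (Fin m),
      Module.finrank ℂ (↥(highestWeightSpace (orbitCoordRep (∏ i : Fin m, (X i : MvPolynomial (Fin m) ℂ)) m) χ) ⧸ Submodule.comap (highestWeightSpace (orbitCoordRep (∏ i : Fin m, (X i : MvPolynomial (Fin m) ℂ)) m) χ).subtype (⨆ p : Weight (Fin m) × Weight (Fin m), ⨆ (_ : p.1 + p.2 = χ ∧ p.1 ≠ 0 ∧ p.2 ≠ 0), highestWeightSpace (orbitCoordRep (∏ i : Fin m, (X i : MvPolynomial (Fin m) ℂ)) m) p.1 * highestWeightSpace (orbitCoordRep (∏ i : Fin m, (X i : MvPolynomial (Fin m) ℂ)) m) p.2)) ≠ 0 ∧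
        (m : ℤ) * 2 ^ ((Nat.log 2 m + c) ^ c) < -(Weight.size χ)) := by
  constructor
  · intro hC c m₀
    obtain ⟨m, hm, ψ, hγ, hlt⟩ := hC c m₀
    obtain ⟨ι, hι, hup⟩ := exists_finalSegment_fin m
    obtain ⟨hext, hγ'⟩ := (chowDiag_genType_iff hι hup ψ).mp hγ
    refine ⟨m, hm, ψ ∘ ι, hγ', ?_⟩
    rwa [← size_extend hι.injective (ψ ∘ ι), hext]
  · intro hC c m₀
    obtain ⟨m, hm, χ, hγ, hlt⟩ := hC c m₀
    obtain ⟨ι, hι, hup⟩ := exists_finalSegment_fin m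
    refine ⟨m, hm, Function.extend ι χ 0, ?_, ?_⟩
    · rw [gamma_chowDiag_extend_eq hι hup χ]
      exact hγ
    · rwa [size_extend hι.injective χ]

/-- **The Chow dichotomy on the own letters.**  If, for every `c` and cofinally in `m`, the
covariant algebra of `Ch_m(ℂ^m) = Δ_{GL_m}(x₀⋯x_{m-1})` (own `m` letters) has a generator type
`χ` of degree `-|χ| > m · 2^((log₂ m + c)^c)`, then K1 = `PerGenDegreeSuperQP`
(stmt-ValiantsHypothesis-11654) holds and K2 = `PowGenDegreeQP` (stmt-ValiantsHypothesis-11655)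
fails.  (`chowLate_iff_chowLateOwn` into the tree's `chowLate_dichotomy`.) [folklore] -/
theorem chowLateOwn_dichotomy
    (hC : ∀ c m₀ : ℕ, ∃ m : ℕ, m₀ ≤ m ∧ ∃ χ : Weight (Fin m),
      Module.finrank ℂ (↥(highestWeightSpace (orbitCoordRep (∏ i : Fin m, (X i : MvPolynomial (Fin m) ℂ)) m) χ) ⧸ Submodule.comap (highestWeightSpace (orbitCoordRep (∏ i : Fin m, (X i : MvPolynomial (Fin m) ℂ)) m) χ).subtype (⨆ p : Weight (Fin m) × Weight (Fin m), ⨆ (_ : p.1 + p.2 = χ ∧ p.1 ≠ 0 ∧ p.2 ≠ 0), highestWeightSpace (orbitCoordRep (∏ i : Fin m, (X i : MvPolynomial (Fin m) ℂ)) m) p.1 * highestWeightSpace (orbitCoordRep (∏ i : Fin m, (X i : MvPolynomial (Fin m) ℂ)) m) p.2)) ≠ 0 ∧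
        (m : ℤ) * 2 ^ ((Nat.log 2 m + c) ^ c) < -(Weight.size χ)) :
    PerGenDegreeSuperQP ∧ ¬ PowGenDegreeQP :=
  chowLate_dichotomy (chowLate_iff_chowLateOwn.mpr hC)

/-- **`stub_sliceGen ⇒` quasi-polynomial generation of `A(Ch_m(ℂ^m))`** (registered stub of the
line `trace-side-regimes` as hypothesis, verbatim): every generator type `χ : Fin m → ℤ` of the
covariant algebra of `Δ_{GL_m}(x₀⋯x_{m-1})` has `-|χ| ≤ m · 2^((log₂ m + c₀)^c₀)` whenever
`m ≤ 2^((log₂ m + c)^c)` (automatic for `c ≥ 1`).  (`chowGenQP_of_sliceGen` transported by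
`gamma_chowDiag_extend_eq`.) [folklore] -/
theorem chowGenQPOwn_of_sliceGen
    (hS : ∀ c : ℕ, ∃ c₀ : ℕ, ∀ m e : ℕ, 1 ≤ m → m + e ≤ 2 ^ ((Nat.log 2 m + c) ^ c) →
      ∀ ι : MatIdx m → MatIdx (m + e), StrictMono ι → IsUpperSet (Set.range ι) →
        ∀ χ : Weight (MatIdx m),
          Module.finrank ℂ (↥(highestWeightSpace (orbitCoordRep (powFormLex ℂ (m + e) m) m) (Function.extend ι χ 0)) ⧸ Submodule.comap (highestWeightSpace (orbitCoordRep (powFormLex ℂ (m + e) m) m) (Function.extend ι χ 0)).subtype (⨆ p : Weight (MatIdx (m + e)) × Weight (MatIdx (m + e)), ⨆ (_ : p.1 + p.2 = (Function.extend ι χ 0) ∧ p.1 ≠ 0 ∧ p.2 ≠ 0), highestWeightSpace (orbitCoordRep (powFormLex ℂ (m + e) m) m) p.1 * highestWeightSpace (orbitCoordRep (powFormLex ℂ (m + e) m) m) p.2)) ≠ 0 →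
            -(Weight.size χ) ≤ (m : ℤ) * 2 ^ ((Nat.log 2 m + c₀) ^ c₀)) :
    ∀ c : ℕ, ∃ c₀ : ℕ, ∀ m : ℕ, 1 ≤ m → m ≤ 2 ^ ((Nat.log 2 m + c) ^ c) →
      ∀ χ : Weight (Fin m),
        Module.finrank ℂ (↥(highestWeightSpace (orbitCoordRep (∏ i : Fin m, (X i : MvPolynomial (Fin m) ℂ)) m) χ) ⧸ Submodule.comap (highestWeightSpace (orbitCoordRep (∏ i : Fin m, (X i : MvPolynomial (Fin m) ℂ)) m) χ).subtype (⨆ p : Weight (Fin m) × Weight (Fin m), ⨆ (_ : p.1 + p.2 = χ ∧ p.1 ≠ 0 ∧ p.2 ≠ 0), highestWeightSpace (orbitCoordRep (∏ i : Fin m, (X i : MvPolynomial (Fin m) ℂ)) m) p.1 * highestWeightSpace (orbitCoordRep (∏ i : Fin m, (X i : MvPolynomial (Fin m) ℂ)) m) p.2)) ≠ 0 →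
          -(Weight.size χ) ≤ (m : ℤ) * 2 ^ ((Nat.log 2 m + c₀) ^ c₀) := by
  intro c
  obtain ⟨c₀, hc₀⟩ := chowGenQP_of_sliceGen hS c
  refine ⟨c₀, fun m hm hwin χ hγ => ?_⟩
  obtain ⟨ι, hι, hup⟩ := exists_finalSegment_fin m
  have h := hc₀ m hm hwin (Function.extend ι χ 0) (by rw [gamma_chowDiag_extend_eq hι hup χ]; exact hγ)
  rwa [size_extend hι.injective χ] at h

/-- **K2 `⇒` quasi-polynomial generation of `A(Ch_m(ℂ^m))`**: the route's crux `PowGenDegreeQP`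
(verbatim) already bounds every generator type of the covariant algebra of the Chow variety in its
own `m` letters by `-|χ| ≤ m · 2^((log₂ m + c₀)^c₀)`. [folklore] -/
theorem chowGenQPOwn_of_powGenDegreeQP (hK2 : PowGenDegreeQP) :
    ∀ c : ℕ, ∃ c₀ : ℕ, ∀ m : ℕ, 1 ≤ m → m ≤ 2 ^ ((Nat.log 2 m + c) ^ c) →
      ∀ χ : Weight (Fin m),
        Module.finrank ℂ (↥(highestWeightSpace (orbitCoordRep (∏ i : Fin m, (X i : MvPolynomial (Fin m) ℂ)) m) χ) ⧸ Submodule.comap (highestWeightSpace (orbitCoordRep (∏ i : Fin m, (X i : MvPolynomial (Fin m) ℂ)) m) χ).subtype (⨆ p : Weight (Fin m) × Weight (Fin m), ⨆ (_ : p.1 + p.2 = χ ∧ p.1 ≠ 0 ∧ p.2 ≠ 0), highestWeightSpace (orbitCoordRep (∏ i : Fin m, (X i : MvPolynomial (Fin m) ℂ)) m) p.1 * highestWeightSpace (orbitCoordRep (∏ i : Fin m, (X i : MvPolynomial (Fin m) ℂ)) m) p.2)) ≠ 0 →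
          -(Weight.size χ) ≤ (m : ℤ) * 2 ^ ((Nat.log 2 m + c₀) ^ c₀) :=
  chowGenQPOwn_of_sliceGen (sliceGen_of_powGenDegreeQP hK2)

/-- **Late own-letter Chow generators refute `stub_sliceGen`** (conclusion of the registered stub,
negated): at `c = 1` the window contains `n = m`, and `chowGenQPOwn_of_sliceGen` would bound the
late generator. [folklore] -/
theorem not_sliceGen_of_chowLateOwn
    (hC : ∀ c m₀ : ℕ, ∃ m : ℕ, m₀ ≤ m ∧ ∃ χ : Weight (Fin m),
      Module.finrank ℂ (↥(highestWeightSpace (orbitCoordRep (∏ i : Fin m, (X i : MvPolynomial (Fin m) ℂ)) m) χ) ⧸ Submodule.comap (highestWeightSpace (orbitCoordRep (∏ i : Fin m, (X i : MvPolynomial (Fin m) ℂ)) m) χ).subtype (⨆ p : Weight (Fin m) × Weight (Fin m), ⨆ (_ : p.1 + p.2 = χ ∧ p.1 ≠ 0 ∧ p.2 ≠ 0), highestWeightSpace (orbitCoordRep (∏ i : Fin m, (X i : MvPolynomial (Fin m) ℂ)) m) p.1 * highestWeightSpace (orbitCoordRep (∏ i : Fin m, (X i : MvPolynomial (Fin m)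 ℂ)) m) p.2)) ≠ 0 ∧
        (m : ℤ) * 2 ^ ((Nat.log 2 m + c) ^ c) < -(Weight.size χ)) :
    ¬ (∀ c : ℕ, ∃ c₀ : ℕ, ∀ m e : ℕ, 1 ≤ m → m + e ≤ 2 ^ ((Nat.log 2 m + c) ^ c) →
      ∀ ι : MatIdx m → MatIdx (m + e), StrictMono ι → IsUpperSet (Set.range ι) →
        ∀ χ : Weight (MatIdx m),
          Module.finrank ℂ (↥(highestWeightSpace (orbitCoordRep (powFormLex ℂ (m + e) m) m) (Function.extend ι χ 0)) ⧸ Submodule.comap (highestWeightSpace (orbitCoordRep (powFormLex ℂ (m + e) m) m) (Function.extend ι χ 0)).subtype (⨆ p : Weight (MatIdx (m + e)) × Weight (MatIdx (m + e)), ⨆ (_ : p.1 + p.2 = (Function.extend ι χ 0) ∧ p.1 ≠ 0 ∧ p.2 ≠ 0), highestWeightSpace (orbitCoordRep (powFormLex ℂ (m + e) m) m) p.1 * highestWeightSpace (orbitCoordRep (powFormLex ℂ (m + e) m) m) p.2)) ≠ 0 →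
            -(Weight.size χ) ≤ (m : ℤ) * 2 ^ ((Nat.log 2 m + c₀) ^ c₀)) :=
  not_sliceGen_of_chowLate (chowLate_iff_chowLateOwn.mpr hC)

end Late

/-! ## 5. Appendix (gen3, same session): the quasi-polynomial generation statements are equivalent too -/

section QPEquiv

/-- **Quasi-polynomial generation of `A(Ch_m(ℂ^{m²}))` ⟺ of `A(Ch_m(ℂ^m))`.**  The conclusion of the
tree's `chowGenQP_of_sliceGen` (Chow covariant algebra in the `m²` matrix letters generated in
degree `m · 2^((log₂ m + c₀)^c₀)` throughout `m ≤ 2^((log₂ m + c)^c)`) is EQUIVALENT to the same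
statement for the own-letter algebra `A(Δ_{GL_m}(x₀⋯x_{m-1}))` (`chowDiag_genType_iff`: generator
types correspond by `ψ ↦ ψ ∘ ι`, `χ ↦ ext_ι χ`, with equal sizes).  So both the LATE statement
(`chowLate_iff_chowLateOwn`) and its quasi-polynomial negation-shape live on `m` letters. [folklore] -/
theorem chowGenQP_iff_chowGenQPOwn :
    (∀ c : ℕ, ∃ c₀ : ℕ, ∀ m : ℕ, 1 ≤ m → m ≤ 2 ^ ((Nat.log 2 m + c) ^ c) →
      ∀ χ : Weight (MatIdx m),
        Module.finrank ℂ (↥(highestWeightSpace (orbitCoordRep (∏ i : Fin m, (X (toLex (i, i)) : MvPolynomial (MatIdx m) ℂ)) m) χ) ⧸ Submodule.comap (highestWeightSpace (orbitCoordRep (∏ i : Fin m, (X (toLex (i, i)) : MvPolynomial (MatIdx m) ℂ)) m) χ).subtype (⨆ p : Weight (MatIdx m) × Weight (MatIdx m), ⨆ (_ : p.1 + p.2 = χ ∧ p.1 ≠ 0 ∧ p.2 ≠ 0), highestWeightSpace (orbitCoordRep (∏ i : Fin m, (X (toLex (i, i)) : MvPolynomial (MatIdx m) ℂ)) m) p.1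 * highestWeightSpace (orbitCoordRep (∏ i : Fin m, (X (toLex (i, i)) : MvPolynomial (MatIdx m) ℂ)) m) p.2)) ≠ 0 →
          -(Weight.size χ) ≤ (m : ℤ) * 2 ^ ((Nat.log 2 m + c₀) ^ c₀)) ↔
    (∀ c : ℕ, ∃ c₀ : ℕ, ∀ m : ℕ, 1 ≤ m → m ≤ 2 ^ ((Nat.log 2 m + c) ^ c) →
      ∀ χ : Weight (Fin m),
        Module.finrank ℂ (↥(highestWeightSpace (orbitCoordRep (∏ i : Fin m, (X i : MvPolynomial (Fin m) ℂ)) m) χ) ⧸ Submodule.comap (highestWeightSpace (orbitCoordRep (∏ i : Fin m, (X i : MvPolynomial (Fin m) ℂ)) m) χ).subtype (⨆ p : Weight (Fin m) × Weight (Fin m), ⨆ (_ : p.1 + p.2 = χ ∧ p.1 ≠ 0 ∧ p.2 ≠ 0), highestWeightSpace (orbitCoordRep (∏ i : Fin m, (X i : MvPolynomial (Fin m) ℂ)) m) p.1 * highestWeightSpace (orbitCoordRep (∏ i : Fin m, (X i : MvPolynomial (Fin m) ℂ)) m) p.2)) ≠ 0 →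
          -(Weight.size χ) ≤ (m : ℤ) * 2 ^ ((Nat.log 2 m + c₀) ^ c₀)) := by
  constructor
  · intro h c
    obtain ⟨c₀, hc₀⟩ := h c
    refine ⟨c₀, fun m hm hwin χ hγ => ?_⟩
    obtain ⟨ι, hι, hup⟩ := exists_finalSegment_fin m
    have hb := hc₀ m hm hwin (Function.extend ι χ 0)
      (by rw [gamma_chowDiag_extend_eq hι hup χ]; exact hγ)
    rwa [size_extend hι.injective χ] at hb
  · intro h c
    obtain ⟨c₀, hc₀⟩ := h c
    refine ⟨c₀, fun m hm hwin ψ hγ => ?_⟩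
    obtain ⟨ι, hι, hup⟩ := exists_finalSegment_fin m
    obtain ⟨hext, hγ'⟩ := (chowDiag_genType_iff hι hup ψ).mp hγ
    have hb := hc₀ m hm hwin (ψ ∘ ι) hγ'
    rwa [← size_extend hι.injective (ψ ∘ ι), hext] at hb

end QPEquiv

end

end Summit.ValiantsHypothesis.ValiantsHypothesis.Theorems.GeneratorObstructions.PowGenDegreeQP
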